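import Literature.Analysis.FluidPDE.PeriodicEnergyAxis
import Literature.Analysis.FluidPDE.PeriodicLogSliceAxis
import HarnessLib

/-!
# Lei–Ren–Zhang 2019, (3.3)–(3.4): the viscous and drift cut-off terms of the logarithmic estimate per period

Analysis/FluidPDE proofs file (theorems only, no definitions, no named facts), on the discharge
path of the named fact `Literature.Analysis.FluidPDE.leiRenZhang2019_liouville_periodic`
(Z. Lei, X. Ren, Q. S. Zhang, arXiv:1902.11229 = Math. Ann. 383 (2022), Theorem 1.1). Proof of
Lemma 3.1 (arXiv p. 7): the cut-off term of (3.3) ("`−∇Ψ·∇ζ_R² ≤ (1/6)|∇Ψ|²ζ_R² + C|∇ζ_R|²`") and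
the drift term (3.4) ("`∫ −b·∇Ψζ_R² = … = ∫(L_θ(r,z,t) − L_θ(r,0,t))∂ᵣζ_R²∂_zΨ ≤ C + (1/6)∫|∇Ψ|²ζ_R²`"),
per period and in the tree's `H`-calculus (general `H ∈ C²`; for the paper `H = −ln`,
`H'(F)²‖∇F‖² = |∇Ψ|²`), with the drift written through the angular stream potential `Φ`
(`∂_zΦ = ⟪b, x_h⟫`, `|Φ| ≤ C_Φ r`, `PeriodicDriftPotential`) and integrated by parts in `z` over
one period (the window device of `PeriodicSwirlEnergy.drift_window_le`):

* `setIntegral_norm_gradient_cylCutoff_sq_le` — `∫_{slab} ‖∇ζ‖² ≤ 16 C_φ² P` for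
  `ζ = cylCutoff (ρ/2) ρ`;
* `abs_viscous_cutoff_term_le_periodic` — `|∫_{slab} H'(F)⟪∇F, ∇ψ²⟫| ≤ ε∫_{slab}H'(F)²‖∇F‖²ψ² + ε⁻¹∫_{slab}‖∇ψ‖²`;
* `abs_drift_term_le_periodic` — `|∫_{slab} H(F)⟪b, ∇ψ²⟫| ≤ ε∫_{slab}H'(F)²‖∇F‖²ψ² + (C_Φ²/ε)∫_{slab}‖∇ψ‖²`.

## References

* Z. Lei, X. Ren, Q. S. Zhang, arXiv:1902.11229, §3, proof of Lemma 3.1, (3.3)–(3.4) (arXiv p. 7).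
  [LeiRenZhang2019]
* Z. Lei, Q. S. Zhang, arXiv:1011.5066, proof of Lemma 3.2 (p. 9) (tree `LeiZhang2011LogSlice`).
  [LeiZhang2011]
-/

noncomputable section

open MeasureTheory Set Function Filter Metric intervalIntegral
open _root_.Topology
open scoped InnerProductSpace RealInnerProductSpace NNReal ENNReal

namespace Literature.Analysis.FluidPDE

namespace LeiRenZhang2019

open LeiZhang2011

/-! ### Plumbing (copies of the private helpers of `PeriodicSwirlEnergy`) -/

/-- `‖e_z‖ = 1`. [folklore] -/
private theorem norm_eZ_pld : ‖(eZ : EuclideanSpace ℝ (Fin 3))‖ = 1 := by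
  have h : (eZ : EuclideanSpace ℝ (Fin 3)) = PiLp.single 2 (2 : Fin 3) (1 : ℝ) := rfl
  rw [h, PiLp.norm_single, norm_one]

/-- Unfolding of axial periodicity with `eZ`. [folklore] -/
private theorem periodic_apply_pld {α : Sort*} {P : ℝ} {Q : EuclideanSpace ℝ (Fin 3) → α}
    (hQ : IsAxiallyPeriodic P Q) (x : EuclideanSpace ℝ (Fin 3)) : Q (x + P • eZ) = Q x :=
  hQ x

/-- Axial periodicity from its `eZ` form. [folklore] -/
private theorem periodic_of_eZ_pld {α : Sort*} {P : ℝ} {Q : EuclideanSpace ℝ (Fin 3) → α}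
    (hQ : ∀ x : EuclideanSpace ℝ (Fin 3), Q (x + P • eZ) = Q x) : IsAxiallyPeriodic P Q :=
  hQ

/-- A function invariant under all axial translations is axially periodic. [folklore] -/
private theorem periodic_of_forall_add_smul_pld {α : Sort*} {P : ℝ} {c : EuclideanSpace ℝ (Fin 3) → α}
    (hc : ∀ (x : EuclideanSpace ℝ (Fin 3)) (t : ℝ), c (x + t • eZ) = c x) : IsAxiallyPeriodic P c :=
  fun x => hc x P

/-- The derivative of a periodic function is periodic. [folklore] -/
private theorem periodic_fderiv_pld {P : ℝ} {f : EuclideanSpace ℝ (Fin 3) → ℝ}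
    (hf : IsAxiallyPeriodic P f) : IsAxiallyPeriodic P (fderiv ℝ f) := by
  intro x
  have hfun : (fun y => f (y + P • EuclideanSpace.single (2 : Fin 3) (1 : ℝ))) = f := funext hf
  have h := fderiv_comp_add_right (𝕜 := ℝ) (f := f) (x := x)
    (P • EuclideanSpace.single (2 : Fin 3) (1 : ℝ))
  rw [hfun] at h
  exact h.symm

/-- **The axial derivative of a `z`-invariant function vanishes.** [folklore] -/
private theorem fderiv_eZ_eq_zero_of_forall_add_smul_pld {c : EuclideanSpace ℝ (Fin 3) → ℝ}
    {x : EuclideanSpace ℝ (Fin 3)} (hcd : DifferentiableAt ℝ c x)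
    (hc : ∀ t : ℝ, c (x + t • eZ) = c x) : fderiv ℝ c x eZ = 0 := by
  have hline : HasDerivAt (fun t : ℝ => x + t • (eZ : EuclideanSpace ℝ (Fin 3))) eZ 0 := by
    have h := ((hasDerivAt_id (0 : ℝ)).smul_const (eZ : EuclideanSpace ℝ (Fin 3))).const_add x
    simpa using h
  have hx0 : x + (0 : ℝ) • (eZ : EuclideanSpace ℝ (Fin 3)) = x := by simp
  have hcd' : DifferentiableAt ℝ c (x + (0 : ℝ) • (eZ : EuclideanSpace ℝ (Fin 3))) := by rwa [hx0]
  have hcomp := hcd'.hasFDerivAt.comp_hasDerivAt (0 : ℝ) hline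
  rw [hx0] at hcomp
  have hconst : HasDerivAt (fun t : ℝ => c (x + t • (eZ : EuclideanSpace ℝ (Fin 3)))) 0 0 := by
    have : (fun t : ℝ => c (x + t • (eZ : EuclideanSpace ℝ (Fin 3)))) = fun _ => c x := funext hc
    rw [this]
    exact hasDerivAt_const _ _
  exact hcomp.unique hconst

/-- `|∂_z F| ≤ ‖∇F‖`. [folklore] -/
private theorem abs_fderiv_eZ_le_norm_gradient_pld (F : EuclideanSpace ℝ (Fin 3) → ℝ)
    (x : EuclideanSpace ℝ (Fin 3)) : |fderiv ℝ F x eZ| ≤ ‖gradient F x‖ := by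
  rw [← inner_gradient_left, ← Real.norm_eq_abs]
  calc ‖⟪gradient F x, eZ⟫‖ ≤ ‖gradient F x‖ * ‖(eZ : EuclideanSpace ℝ (Fin 3))‖ := norm_inner_le_norm _ _
    _ = ‖gradient F x‖ := by rw [norm_eZ_pld, mul_one]

/-- `∇(φ²) = 2φ ∇φ`. [folklore] -/
private theorem gradient_sq_pld {φ : EuclideanSpace ℝ (Fin 3) → ℝ} {x : EuclideanSpace ℝ (Fin 3)}
    (hd : DifferentiableAt ℝ φ x) : gradient (fun y => φ y ^ 2) x = (2 * φ x) • gradient φ x := by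
  have h := gradient_comp_apply (H := fun t : ℝ => t ^ 2) (F := φ) ((differentiable_pow 2) (φ x)) hd
  simp only [deriv_pow_field, Nat.cast_ofNat, Nat.add_one_sub_one, pow_one] at h
  exact h

/-- The periodic window is supported in `|z| ≤ 2P`. [folklore] -/
private theorem abs_le_of_periodicWindow_ne_zero_pld {P : ℝ} (hP : 0 < P) (z : ℝ)
    (hz : periodicWindow P z ≠ 0) : |z| ≤ 2 * P := by
  have h := mem_Ioo_of_periodicWindow_ne_zero hP hz
  rw [abs_le]
  exact ⟨by linarith [h.1], h.2.le⟩

/-- The squared window is supported in `|z| ≤ 2P`. [folklore] -/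
private theorem abs_le_of_periodicWindow_sq_ne_zero_pld {P : ℝ} (hP : 0 < P) (z : ℝ)
    (hz : periodicWindow P z ^ 2 ≠ 0) : |z| ≤ 2 * P :=
  abs_le_of_periodicWindow_ne_zero_pld hP z fun h => hz (by rw [h]; ring)

/-- A function vanishing for `r ≥ ρ` has zero derivative for `r > ρ`. [folklore] -/
private theorem fderiv_eq_zero_of_lt_cylRadius_pld {ψ : EuclideanSpace ℝ (Fin 3) → ℝ} {ρ : ℝ}
    (hψ0 : ∀ x, ρ ≤ cylRadius x → ψ x = 0) {x : EuclideanSpace ℝ (Fin 3)} (hx : ρ < cylRadius x) :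
    fderiv ℝ ψ x = 0 := by
  have hopen : IsOpen {y : EuclideanSpace ℝ (Fin 3) | ρ < cylRadius y} :=
    isOpen_lt continuous_const continuous_cylRadius
  have hev : ψ =ᶠ[𝓝 x] fun _ => 0 := by
    filter_upwards [hopen.mem_nhds hx] with y hy
    exact hψ0 y (le_of_lt hy)
  rw [hev.fderiv_eq, fderiv_const_apply]

/-- Hence `‖∇ψ‖` vanishes for `r ≥ ρ + 1`. [folklore] -/
private theorem gradient_eq_zero_of_le_cylRadius_pld {ψ : EuclideanSpace ℝ (Fin 3) → ℝ} {ρ : ℝ}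
    (hψ0 : ∀ x, ρ ≤ cylRadius x → ψ x = 0) {x : EuclideanSpace ℝ (Fin 3)} (hx : ρ + 1 ≤ cylRadius x) :
    gradient ψ x = 0 := by
  rw [gradient, fderiv_eq_zero_of_lt_cylRadius_pld hψ0 (by linarith), map_zero]

/-- A nonnegative cut-off has zero gradient where it vanishes. [folklore] -/
private theorem gradient_eq_zero_of_nonneg_eq_zero_pld {ψ : EuclideanSpace ℝ (Fin 3) → ℝ}
    (hψ0 : ∀ y, 0 ≤ ψ y) {x : EuclideanSpace ℝ (Fin 3)} (hx : ψ x = 0) : gradient ψ x = 0 := by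
  have hmin : IsLocalMin ψ x := Filter.Eventually.of_forall fun y => by rw [hx]; exact hψ0 y
  rw [gradient, hmin.fderiv_eq_zero, map_zero]

/-- The closed period box `[0, L] × {r ≤ ρ}` is compact. [folklore] -/
private theorem isCompact_box_pld (L ρ : ℝ) :
    IsCompact {x : EuclideanSpace ℝ (Fin 3) | x 2 ∈ Icc 0 L ∧ cylRadius x ≤ ρ} := by
  have hx2 : Continuous fun x : EuclideanSpace ℝ (Fin 3) => x 2 :=
    (EuclideanSpace.proj (𝕜 := ℝ) (2 : Fin 3)).continuous
  refine Metric.isCompact_of_isClosed_isBounded ?_ ?_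
  · exact (isClosed_Icc.preimage hx2).inter (isClosed_le continuous_cylRadius continuous_const)
  · refine (Metric.isBounded_closedBall (x := (0 : EuclideanSpace ℝ (Fin 3))) (r := ρ + |L|)).subset
      fun x hx => ?_
    rw [mem_closedBall_zero_iff]
    have h := norm_le_cylRadius_add_abs_apply_two x
    have h2 : |x 2| ≤ |L| := by
      rw [abs_le]
      exact ⟨by linarith [hx.1.1, abs_nonneg L], hx.1.2.trans (le_abs_self L)⟩
    linarith [hx.2]

/-! ### The gradient mass of the cylindrical cut-off per period -/

/-- **`∫_{slab} ‖∇ζ‖² ≤ 16 C_φ² P`** for `ζ = cylCutoff (ρ/2) ρ`, `P, ρ > 0` (`‖∇ζ‖ ≤ 2C_φ/ρ`,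
`∇ζ = 0` off `{r < ρ}`, `|slab ∩ {r ≤ ρ}| ≤ 4ρ²P`): the constant "`C∫|∇ζ_R|²`" of (3.3) per period. [cite: LeiRenZhang2019, §3 (3.3) (the term C|∇ζ_R|² integrated over one period, |D_R| ∼ R²), arXiv p. 7] -/
theorem setIntegral_norm_gradient_cylCutoff_sq_le {P ρ Cφ : ℝ} (hP : 0 < P) (hρ : 0 < ρ)
    (hCφ : ∀ ρ₂ ρ₁ : ℝ, 0 ≤ ρ₂ → ρ₂ < ρ₁ → ∀ x : EuclideanSpace ℝ (Fin 3),
      ‖gradient (cylCutoff ρ₂ ρ₁) x‖ ≤ Cφ / (ρ₁ - ρ₂)) :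
    ∫ x in zSlab P 0, ‖gradient (cylCutoff (ρ / 2) ρ) x‖ ^ 2 ≤ 16 * Cφ ^ 2 * P := by
  obtain ⟨-, -, hSvol⟩ := cylCutoff_sq_slab_mass hP hρ
  set φ : EuclideanSpace ℝ (Fin 3) → ℝ := cylCutoff (ρ / 2) ρ with hφdef
  have hρ2 : 0 ≤ ρ / 2 := by positivity
  have hρρ : ρ / 2 < ρ := half_lt_self hρ
  have hD : ∀ x, ‖gradient φ x‖ ≤ Cφ / (ρ - ρ / 2) := fun x => hCφ _ _ hρ2 hρρ x
  have hD0 : 0 ≤ Cφ / (ρ - ρ / 2) := (norm_nonneg _).trans (hD 0)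
  have hφ0 : ∀ x, ρ ≤ cylRadius x → φ x = 0 := fun x hx => cylCutoff_eq_zero hρ2 hρρ hx
  have hg0 : ∀ x, ρ ≤ cylRadius x → gradient φ x = 0 := fun x hx =>
    gradient_eq_zero_of_nonneg_eq_zero_pld (fun y => cylCutoff_nonneg _ _ _) (hφ0 x hx)
  have hgc : Continuous (gradient φ) := continuous_gradient_of_contDiff (contDiff_cylCutoff (ρ / 2) ρ (n := 1))
  have hslab : MeasurableSet (zSlab P 0) := measurableSet_zSlab P 0
  have hcyl : MeasurableSet {x : EuclideanSpace ℝ (Fin 3) | cylRadius x ≤ ρ} :=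
    measurableSet_le continuous_cylRadius.measurable measurable_const
  set S : Set (EuclideanSpace ℝ (Fin 3)) := zSlab P 0 ∩ {x | cylRadius x ≤ ρ} with hS
  have hSK : S ⊆ {x : EuclideanSpace ℝ (Fin 3) | x 2 ∈ Icc 0 P ∧ cylRadius x ≤ ρ} := fun x hx => by
    have h := mem_zSlab.1 hx.1
    simp only [Int.cast_zero, zero_mul, zero_add, one_mul] at h
    exact ⟨⟨h.1, h.2.le⟩, hx.2⟩
  have hS_top : volume S ≠ ∞ := ((measure_mono hSK).trans_lt (isCompact_box_pld P ρ).measure_lt_top).ne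
  have hSm : MeasurableSet S := hslab.inter hcyl
  have hi : IntegrableOn (fun x => ‖gradient φ x‖ ^ 2) (zSlab P 0) volume :=
    integrableOn_zSlab_of_eq_zero_of_le_cylRadius (hgc.norm.pow 2) (ρ := ρ)
      (fun x hx => by simp [hg0 x hx]) P 0
  calc ∫ x in zSlab P 0, ‖gradient φ x‖ ^ 2 = ∫ x in S, ‖gradient φ x‖ ^ 2 :=
        setIntegral_eq_of_subset_of_forall_sdiff_eq_zero hslab inter_subset_left fun x hx => by
          have hr : ¬cylRadius x ≤ ρ := fun h => hx.2 ⟨hx.1, h⟩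
          simp [hg0 x (not_le.1 hr).le]
    _ ≤ ∫ x in S, (Cφ / (ρ - ρ / 2)) ^ 2 := by
        refine setIntegral_mono_on (hi.mono_set inter_subset_left) (integrableOn_const hS_top) hSm fun x _ => ?_
        exact pow_le_pow_left₀ (norm_nonneg _) (hD x) 2
    _ = volume.real S * (Cφ / (ρ - ρ / 2)) ^ 2 := by rw [setIntegral_const, smul_eq_mul]
    _ ≤ 4 * ρ ^ 2 * P * (Cφ / (ρ - ρ / 2)) ^ 2 := mul_le_mul_of_nonneg_right hSvol (sq_nonneg _)
    _ = 16 * Cφ ^ 2 * P := by field_simp; ring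

section Terms

variable {P : ℝ} {F ψ a : EuclideanSpace ℝ (Fin 3) → ℝ} {ρ : ℝ} {H : ℝ → ℝ} {ε : ℝ}

/-- **The viscous cut-off term per period** ((3.3): "`−∇Ψ·∇ζ_R² ≤ (1/6)|∇Ψ|²ζ_R² + C|∇ζ_R|²`", in
the `H`-calculus): for `F ∈ C¹` periodic, `H ∈ C²`, a `z`-independent cut-off `ψ ∈ C¹` vanishing
for `r ≥ ρ`, and `ε > 0`,
`|∫_{slab} H'(F)⟪∇F, ∇ψ²⟫| ≤ ε∫_{slab} H'(F)²‖∇F‖²ψ² + ε⁻¹∫_{slab} ‖∇ψ‖²`. [cite: LeiRenZhang2019, §3 (3.3) (the term −∇Ψ·∇ζ_R² ≤ (1/6)|∇Ψ|²ζ_R² + C|∇ζ_R|² over one period), arXiv p. 7] -/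
theorem abs_viscous_cutoff_term_le_periodic (hF : ContDiff ℝ 1 F) (hH : ContDiff ℝ 2 H)
    (hψ : ContDiff ℝ 1 ψ) (hψ0 : ∀ x, ρ ≤ cylRadius x → ψ x = 0) (hε : 0 < ε) (P : ℝ) :
    |∫ x in zSlab P 0, deriv H (F x) * ⟪gradient F x, gradient (fun y => ψ y ^ 2) x⟫| ≤
      ε * (∫ x in zSlab P 0, deriv H (F x) ^ 2 * ‖gradient F x‖ ^ 2 * ψ x ^ 2) +
        ε⁻¹ * ∫ x in zSlab P 0, ‖gradient ψ x‖ ^ 2 := by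
  have hH' : Continuous (deriv H) := hH.continuous_deriv (by norm_num)
  have hgrad2 : ∀ x, gradient (fun y => ψ y ^ 2) x = (2 * ψ x) • gradient ψ x := fun x =>
    gradient_sq_pld ((hψ.differentiable one_ne_zero) x)
  have hgradF : Continuous (gradient F) := continuous_gradient_of_contDiff hF
  have hgradψ : Continuous (gradient ψ) := continuous_gradient_of_contDiff hψ
  have hgradψ0 : ∀ x, ρ + 1 ≤ cylRadius x → gradient ψ x = 0 := fun x hx =>
    gradient_eq_zero_of_le_cylRadius_pld hψ0 hx
  -- pointwise Young
  have hpt : ∀ x, |deriv H (F x) * ⟪gradient F x, gradient (fun y => ψ y ^ 2) x⟫| ≤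
      ε * (deriv H (F x) ^ 2 * ‖gradient F x‖ ^ 2 * ψ x ^ 2) + ε⁻¹ * ‖gradient ψ x‖ ^ 2 := by
    intro x
    rw [hgrad2 x, real_inner_smul_right, abs_mul, abs_mul]
    have h1 : |⟪gradient F x, gradient ψ x⟫| ≤ ‖gradient F x‖ * ‖gradient ψ x‖ := abs_real_inner_le_norm _ _
    have hA : 0 ≤ |deriv H (F x)| := abs_nonneg _
    have h2 : |deriv H (F x)| * (|2 * ψ x| * |⟪gradient F x, gradient ψ x⟫|) ≤
        2 * (|deriv H (F x)| * ‖gradient F x‖ * |ψ x|) * ‖gradient ψ x‖ := by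
      rw [abs_mul, abs_two]
      calc |deriv H (F x)| * (2 * |ψ x| * |⟪gradient F x, gradient ψ x⟫|)
          ≤ |deriv H (F x)| * (2 * |ψ x| * (‖gradient F x‖ * ‖gradient ψ x‖)) := by gcongr
        _ = 2 * (|deriv H (F x)| * ‖gradient F x‖ * |ψ x|) * ‖gradient ψ x‖ := by ring
    have hy : 2 * (|deriv H (F x)| * ‖gradient F x‖ * |ψ x|) * ‖gradient ψ x‖ ≤
        ε * (|deriv H (F x)| * ‖gradient F x‖ * |ψ x|) ^ 2 + ε⁻¹ * ‖gradient ψ x‖ ^ 2 := by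
      have h := sq_nonneg (ε * (|deriv H (F x)| * ‖gradient F x‖ * |ψ x|) - ‖gradient ψ x‖)
      have hε' : ε⁻¹ * ‖gradient ψ x‖ ^ 2 = (ε * ‖gradient ψ x‖ ^ 2) * ε⁻¹ * ε⁻¹ := by field_simp
      nlinarith [mul_inv_cancel₀ hε.ne', sq_nonneg (‖gradient ψ x‖), hε.le,
        mul_nonneg hε.le (sq_nonneg (|deriv H (F x)| * ‖gradient F x‖ * |ψ x| - ε⁻¹ * ‖gradient ψ x‖)),
        mul_inv_cancel₀ hε.ne']
    calc _ ≤ _ := h2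
      _ ≤ _ := hy
      _ = _ := by rw [mul_pow, mul_pow, sq_abs, sq_abs]
  -- integrability on the slab
  have hcL : Continuous fun x => deriv H (F x) * ⟪gradient F x, gradient (fun y => ψ y ^ 2) x⟫ :=
    (hH'.comp hF.continuous).mul (hgradF.inner (continuous_gradient_of_contDiff (hψ.pow 2)))
  have hL0 : ∀ x, ρ + 1 ≤ cylRadius x → deriv H (F x) * ⟪gradient F x, gradient (fun y => ψ y ^ 2) x⟫ = 0 :=
    fun x hx => by rw [hgrad2 x, hgradψ0 x hx, smul_zero, inner_zero_right, mul_zero]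
  have hiL : IntegrableOn (fun x => deriv H (F x) * ⟪gradient F x, gradient (fun y => ψ y ^ 2) x⟫)
      (zSlab P 0) volume := integrableOn_zSlab_of_eq_zero_of_le_cylRadius hcL hL0 P 0
  have hiR₁ : IntegrableOn (fun x => deriv H (F x) ^ 2 * ‖gradient F x‖ ^ 2 * ψ x ^ 2) (zSlab P 0) volume :=
    integrableOn_zSlab_of_eq_zero_of_le_cylRadius
      ((((hH'.comp hF.continuous).pow 2).mul (hgradF.norm.pow 2)).mul (hψ.continuous.pow 2)) (ρ := ρ)
      (fun x hx => by simp [hψ0 x hx]) P 0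
  have hiR₂ : IntegrableOn (fun x => ‖gradient ψ x‖ ^ 2) (zSlab P 0) volume :=
    integrableOn_zSlab_of_eq_zero_of_le_cylRadius (hgradψ.norm.pow 2) (ρ := ρ + 1)
      (fun x hx => by simp [hgradψ0 x hx]) P 0
  calc |∫ x in zSlab P 0, deriv H (F x) * ⟪gradient F x, gradient (fun y => ψ y ^ 2) x⟫|
      ≤ ∫ x in zSlab P 0, |deriv H (F x) * ⟪gradient F x, gradient (fun y => ψ y ^ 2) x⟫| :=
        abs_integral_le_integral_abs
    _ ≤ ∫ x in zSlab P 0, (ε * (deriv H (F x) ^ 2 * ‖gradient F x‖ ^ 2 * ψ x ^ 2) + ε⁻¹ * ‖gradient ψ x‖ ^ 2) :=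
        integral_mono_of_nonneg (ae_of_all _ fun x => abs_nonneg _) ((hiR₁.const_mul ε).add (hiR₂.const_mul _))
          (ae_of_all _ hpt)
    _ = _ := by
        rw [integral_add (hiR₁.const_mul ε) (hiR₂.const_mul _), MeasureTheory.integral_const_mul,
          MeasureTheory.integral_const_mul]

/-- **The drift term per period** ((3.4), with `v_r = −∂_z(L_θ − L_θ(r,0,t))` written as
`⟪b, x_h⟫ = ∂_zΦ` and integrated by parts in `z` over one period): for `F ∈ C²` periodic, a
`C¹` periodic drift `b` with angular stream potential `Φ ∈ C¹` (periodic, `∂_zΦ = ⟪b, x_h⟫`,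
`|Φ| ≤ C_Φ r`), `H ∈ C²`, a `z`-independent cut-off `ψ ∈ C²` vanishing for `r ≥ ρ` with
`∇ψ = a x_h`, and `ε > 0`,
`|∫_{slab} H(F)⟪b, ∇ψ²⟫| ≤ ε ∫_{slab} H'(F)²‖∇F‖²ψ² + (C_Φ²/ε) ∫_{slab} ‖∇ψ‖²`. [cite: LeiRenZhang2019, §3 (3.4) (the drift term ∫(L_θ − L_θ(r,0,t))∂ᵣζ_R²∂_zΨ ≤ C + (1/6)∫|∇Ψ|²ζ_R² over one period), arXiv p. 7] -/
theorem abs_drift_term_le_periodic (hP : 0 < P) (hF : ContDiff ℝ 2 F) (hFp : IsAxiallyPeriodic P F)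
    {b : EuclideanSpace ℝ (Fin 3) → EuclideanSpace ℝ (Fin 3)} (hb1 : ContDiff ℝ 1 b)
    (hbp : IsAxiallyPeriodic P b)
    {Φ : EuclideanSpace ℝ (Fin 3) → ℝ} (hΦ1 : ContDiff ℝ 1 Φ) (hΦp : IsAxiallyPeriodic P Φ)
    (hΦz : ∀ x, fderiv ℝ Φ x eZ = ⟪b x, horizPart x⟫) {CΦ : ℝ} (hCΦ : 0 ≤ CΦ)
    (hΦb : ∀ x, |Φ x| ≤ CΦ * cylRadius x)
    (hH : ContDiff ℝ 2 H)
    (hψ : ContDiff ℝ 2 ψ) (hψz : ∀ (x : EuclideanSpace ℝ (Fin 3)) (t : ℝ), ψ (x + t • eZ) = ψ x)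
    (hψ0 : ∀ x, ρ ≤ cylRadius x → ψ x = 0)
    (ha : ContDiff ℝ 1 a) (haz : ∀ (x : EuclideanSpace ℝ (Fin 3)) (t : ℝ), a (x + t • eZ) = a x)
    (hψg : ∀ x, gradient ψ x = a x • horizPart x) (hε : 0 < ε) :
    |∫ x in zSlab P 0, H (F x) * ⟪b x, gradient (fun y => ψ y ^ 2) x⟫| ≤
      ε * (∫ x in zSlab P 0, deriv H (F x) ^ 2 * ‖gradient F x‖ ^ 2 * ψ x ^ 2) +
        CΦ ^ 2 / ε * ∫ x in zSlab P 0, ‖gradient ψ x‖ ^ 2 := by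
  rw [← drift_window_eq hP hF hFp hb1.continuous hbp hH hψ hψz hψ0]
  have hψ' : ContDiff ℝ 1 ψ := hψ.of_le one_le_two
  have hF1 : ContDiff ℝ 1 F := hF.of_le one_le_two
  have hH1 : ContDiff ℝ 1 H := hH.of_le one_le_two
  have hH' : ContDiff ℝ 1 (deriv H) := by
    have h2 : ContDiff ℝ (1 + 1) H := by rw [one_add_one_eq_two]; exact hH
    exact h2.deriv'
  have hψp : IsAxiallyPeriodic P ψ := periodic_of_forall_add_smul_pld hψz
  have hap : IsAxiallyPeriodic P a := periodic_of_forall_add_smul_pld haz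
  set ω2 : ℝ → ℝ := fun z => periodicWindow P z ^ 2 with hω2
  have hW2 : ∀ z, ω2 z ≠ 0 → |z| ≤ 2 * P := fun z hz => abs_le_of_periodicWindow_sq_ne_zero_pld hP z hz
  have hW2C : ContDiff ℝ 1 ω2 := contDiff_periodicWindow_sq P (n := 1)
  have hW2c : Continuous ω2 := hW2C.continuous
  have hW2' : Continuous (deriv ω2) := hW2C.continuous_deriv le_rfl
  have hW2'cs : HasCompactSupport (deriv ω2) := (hasCompactSupport_periodicWindow_sq hP).deriv
  obtain ⟨A, hA⟩ : ∃ A : ℝ, ∀ z, deriv ω2 z ≠ 0 → |z| ≤ A := by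
    obtain ⟨A, hA⟩ := (hW2'cs.isCompact.isBounded).subset_closedBall 0
    exact ⟨A, fun z hz => by
      have := hA (subset_tsupport _ (mem_support.2 hz))
      rwa [mem_closedBall_zero_iff, Real.norm_eq_abs] at this⟩
  have hx2c : Continuous fun x : EuclideanSpace ℝ (Fin 3) => x 2 :=
    (EuclideanSpace.proj (𝕜 := ℝ) (2 : Fin 3)).continuous
  -- `⟪b, ∇φ̃²⟫ = 2ψ a ∂_zΦ ω² + ψ² b_z (ω²)'`
  have hgrad2 : ∀ x, gradient (fun y => ψ y ^ 2) x = (2 * ψ x) • gradient ψ x := fun x =>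
    gradient_sq_pld ((hψ'.differentiable one_ne_zero) x)
  -- the `C¹` coefficient `c = 2ψa`
  set c : EuclideanSpace ℝ (Fin 3) → ℝ := fun x => 2 * ψ x * a x with hc
  have hc1 : ContDiff ℝ 1 c := (contDiff_const.mul hψ').mul ha
  have hcz : ∀ (x : EuclideanSpace ℝ (Fin 3)) (t : ℝ), c (x + t • eZ) = c x := fun x t => by
    simp only [hc, hψz, haz]
  have hsplit : ∀ x, H (F x) * ⟪b x, gradient (fun y => (ψ y * periodicWindow P (y 2)) ^ 2) x⟫ =
      fderiv ℝ Φ x eZ * (c x * H (F x) * ω2 (x 2)) +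
        (H (F x) * ψ x ^ 2 * (b x) 2) * deriv ω2 (x 2) := by
    intro x
    rw [gradient_windowCutoff_sq P hψ' x, inner_add_right, real_inner_smul_right, real_inner_smul_right,
      hgrad2 x, real_inner_smul_right, hψg x, real_inner_smul_right, ← hΦz x]
    have : ⟪b x, (eZ : EuclideanSpace ℝ (Fin 3))⟫ = (b x) 2 := by
      simp [PiLp.inner_apply, eZ]
    rw [this]
    simp only [hc, hω2]
    ring
  -- the `(ω²)'`-junk term vanishes
  set Q₂ : EuclideanSpace ℝ (Fin 3) → ℝ := fun x => H (F x) * ψ x ^ 2 * (b x) 2 with hQ₂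
  have hb2c : Continuous fun x => (b x) 2 := (EuclideanSpace.proj (𝕜 := ℝ) (2 : Fin 3)).continuous.comp hb1.continuous
  have hHFc : Continuous fun x => H (F x) := hH.continuous.comp hF.continuous
  have hQ₂c : Continuous Q₂ := (hHFc.mul (hψ.continuous.pow 2)).mul hb2c
  have hQ₂0 : ∀ x, ρ ≤ cylRadius x → Q₂ x = 0 := fun x hx => by simp only [hQ₂, hψ0 x hx]; ring
  have hQ₂p : IsAxiallyPeriodic P Q₂ := periodic_of_eZ_pld fun x => by
    simp only [hQ₂, periodic_apply_pld hFp, periodic_apply_pld hψp, periodic_apply_pld hbp]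
  obtain ⟨-, hQ₂zero⟩ := integral_mul_window_sq_eq_and_deriv_eq_zero hP hQ₂c hQ₂p hQ₂0
  -- the main term: integrate by parts in `z`
  set Θ : EuclideanSpace ℝ (Fin 3) → ℝ := fun x => c x * H (F x) * ω2 (x 2) with hΘ
  have hcH1 : ContDiff ℝ 1 fun x => c x * H (F x) := hc1.mul (hH1.comp hF1)
  have hΘ1 : ContDiff ℝ 1 Θ := contDiff_mul_comp_apply_two hcH1 hW2C
  have hc0 : ∀ x, ρ ≤ cylRadius x → c x = 0 := fun x hx => by simp only [hc, hψ0 x hx]; ring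
  have hcH0 : ∀ x, ρ ≤ cylRadius x → c x * H (F x) = 0 := fun x hx => by rw [hc0 x hx, zero_mul]
  have hΘc : HasCompactSupport Θ := hasCompactSupport_mul_comp_apply_two (W := ω2) hcH0 hW2
  -- `∂_z Θ = c H'(F) ∂_zF ω² + c H(F) (ω²)'`
  have hΘz : ∀ x, fderiv ℝ Θ x eZ =
      c x * (deriv H (F x) * fderiv ℝ F x eZ) * ω2 (x 2) + c x * H (F x) * deriv ω2 (x 2) := by
    intro x
    have hcd : DifferentiableAt ℝ c x := (hc1.differentiable one_ne_zero) x
    have hHFd : DifferentiableAt ℝ (fun y => H (F y)) x := ((hH1.comp hF1).differentiable one_ne_zero) x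
    have hcHd : DifferentiableAt ℝ (fun y => c y * H (F y)) x := hcd.mul hHFd
    have hW2d : DifferentiableAt ℝ ω2 (x 2) := (hW2C.differentiable one_ne_zero) _
    rw [show Θ = fun y => (fun y => c y * H (F y)) y * ω2 (y 2) from rfl,
      fderiv_mul_comp_apply_two hcHd hW2d, fderiv_fun_mul hcd hHFd]
    have hcz0 : fderiv ℝ c x eZ = 0 := fderiv_eZ_eq_zero_of_forall_add_smul_pld hcd (hcz x)
    have hd : fderiv ℝ (fun y => H (F y)) x = deriv H (F x) • fderiv ℝ F x :=
      ((((hH.differentiable two_ne_zero) (F x)).hasDerivAt).comp_hasFDerivAt x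
        ((hF.differentiable two_ne_zero) x).hasFDerivAt).fderiv
    simp only [_root_.add_apply, FunLike.coe_smul, Pi.smul_apply, smul_eq_mul, hd, hcz0, mul_zero,
      add_zero]
    simp only [eZ, PiLp.single_apply, if_true, mul_one]
    ring
  -- `∫ ∂_z(ΦΘ) = 0`
  have hprod1 : ContDiff ℝ 1 fun x => Φ x * Θ x := hΦ1.mul hΘ1
  have hprodc : HasCompactSupport fun x => Φ x * Θ x := hΘc.mul_left
  have hIBP := integral_fderiv_apply_eq_zero hprod1 hprodc eZ
  have hprodz : ∀ x, fderiv ℝ (fun y => Φ y * Θ y) x eZ =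
      fderiv ℝ Φ x eZ * Θ x + Φ x * fderiv ℝ Θ x eZ := by
    intro x
    rw [fderiv_fun_mul ((hΦ1.differentiable one_ne_zero) x) ((hΘ1.differentiable one_ne_zero) x)]
    simp only [_root_.add_apply, FunLike.coe_smul, Pi.smul_apply, smul_eq_mul]
    ring
  simp_rw [hprodz] at hIBP
  -- integrability of the two products
  have hΘcont : Continuous Θ := hΘ1.continuous
  have hΘzc : Continuous fun x => fderiv ℝ Θ x eZ := (hΘ1.continuous_fderiv one_ne_zero).clm_apply continuous_const
  have hΦzc : Continuous fun x => fderiv ℝ Φ x eZ := (hΦ1.continuous_fderiv one_ne_zero).clm_apply continuous_const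
  have hΘzcs : HasCompactSupport fun x => fderiv ℝ Θ x eZ := hΘc.fderiv_apply (𝕜 := ℝ) eZ
  have hiA : Integrable (fun x => fderiv ℝ Φ x eZ * Θ x) (volume : Measure (EuclideanSpace ℝ (Fin 3))) :=
    (hΦzc.mul hΘcont).integrable_of_hasCompactSupport hΘc.mul_left
  have hiB : Integrable (fun x => Φ x * fderiv ℝ Θ x eZ) (volume : Measure (EuclideanSpace ℝ (Fin 3))) :=
    (hΦ1.continuous.mul hΘzc).integrable_of_hasCompactSupport hΘzcs.mul_left
  rw [integral_add hiA hiB] at hIBP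
  -- the second junk term `∫ Φ c H(F) (ω²)' = 0`
  set Q₃ : EuclideanSpace ℝ (Fin 3) → ℝ := fun x => Φ x * (c x * H (F x)) with hQ₃
  have hQ₃c : Continuous Q₃ := hΦ1.continuous.mul hcH1.continuous
  have hQ₃0 : ∀ x, ρ ≤ cylRadius x → Q₃ x = 0 := fun x hx => by simp only [hQ₃, hcH0 x hx, mul_zero]
  have hcp : IsAxiallyPeriodic P c := periodic_of_forall_add_smul_pld hcz
  have hQ₃p : IsAxiallyPeriodic P Q₃ := periodic_of_eZ_pld fun x => by
    simp only [hQ₃, periodic_apply_pld hΦp, periodic_apply_pld hcp, periodic_apply_pld hFp]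
  obtain ⟨-, hQ₃zero⟩ := integral_mul_window_sq_eq_and_deriv_eq_zero hP hQ₃c hQ₃p hQ₃0
  -- the main term after integration by parts
  set Mn : EuclideanSpace ℝ (Fin 3) → ℝ := fun x =>
    Φ x * (c x * (deriv H (F x) * fderiv ℝ F x eZ)) * ω2 (x 2) with hMn
  have hHFc' : Continuous fun x => deriv H (F x) := (hH.continuous_deriv (by norm_num)).comp hF.continuous
  have hFz : Continuous fun x => fderiv ℝ F x eZ := (hF.continuous_fderiv (by norm_num)).clm_apply continuous_const
  have hMn0 : ∀ x, ρ ≤ cylRadius x → Φ x * (c x * (deriv H (F x) * fderiv ℝ F x eZ)) = 0 := fun x hx => by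
    rw [hc0 x hx]; ring
  have hiMn : Integrable Mn (volume : Measure (EuclideanSpace ℝ (Fin 3))) :=
    ((hΦ1.continuous.mul (hc1.continuous.mul (hHFc'.mul hFz))).mul (hW2c.comp hx2c)).integrable_of_hasCompactSupport
      (hasCompactSupport_mul_comp_apply_two (W := ω2) hMn0 hW2)
  have hiQ₃ : Integrable (fun x => Q₃ x * deriv ω2 (x 2)) (volume : Measure (EuclideanSpace ℝ (Fin 3))) :=
    (hQ₃c.mul (hW2'.comp hx2c)).integrable_of_hasCompactSupport
      (hasCompactSupport_mul_comp_apply_two (W := deriv ω2) hQ₃0 hA)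
  have hBsplit : ∫ x, Φ x * fderiv ℝ Θ x eZ = (∫ x, Mn x) + ∫ x, Q₃ x * deriv ω2 (x 2) := by
    rw [← integral_add hiMn hiQ₃]
    refine integral_congr_ae (Eventually.of_forall fun x => ?_)
    simp only [hΘz x, hMn, hQ₃]
    ring
  rw [hBsplit, hQ₃zero, add_zero] at hIBP
  -- so `∫ ∂_zΦ Θ = −∫ Mn`
  have hmain : ∫ x, fderiv ℝ Φ x eZ * Θ x = -∫ x, Mn x := by linarith
  -- assemble the left-hand side
  have hi2 : Integrable (fun x => Q₂ x * deriv ω2 (x 2)) (volume : Measure (EuclideanSpace ℝ (Fin 3))) :=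
    (hQ₂c.mul (hW2'.comp hx2c)).integrable_of_hasCompactSupport
      (hasCompactSupport_mul_comp_apply_two (W := deriv ω2) hQ₂0 hA)
  have hLHS : ∫ x, H (F x) * ⟪b x, gradient (fun y => (ψ y * periodicWindow P (y 2)) ^ 2) x⟫ =
      -∫ x, Mn x := by
    simp_rw [hsplit]
    rw [integral_add hiA hi2, hQ₂zero, add_zero, hmain]
  rw [hLHS]
  -- pointwise Young on `Mn`: `|Mn| ≤ (ε H'(F)²‖∇F‖²ψ² + ε⁻¹ C_Φ² ‖∇ψ‖²) ω²`
  have hpt : ∀ x, |Mn x| ≤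
      ε * (deriv H (F x) ^ 2 * ‖gradient F x‖ ^ 2 * ψ x ^ 2 * ω2 (x 2)) +
        CΦ ^ 2 / ε * (‖gradient ψ x‖ ^ 2 * ω2 (x 2)) := by
    intro x
    have hw0 : 0 ≤ ω2 (x 2) := sq_nonneg _
    have hΦc : |Φ x * c x| ≤ 2 * |ψ x| * (CΦ * ‖gradient ψ x‖) := by
      rw [hψg x, norm_smul_horizPart, abs_mul]
      simp only [hc, abs_mul, abs_two]
      have h1 := hΦb x
      have h2 : 0 ≤ |a x| := abs_nonneg _
      have h3 : 0 ≤ |ψ x| := abs_nonneg _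
      calc |Φ x| * (2 * |ψ x| * |a x|) ≤ CΦ * cylRadius x * (2 * |ψ x| * |a x|) := by gcongr
        _ = 2 * |ψ x| * (CΦ * (|a x| * cylRadius x)) := by ring
        _ ≤ 2 * |ψ x| * (CΦ * (|a x| * cylRadius x)) := le_rfl
    have hFz' : |fderiv ℝ F x eZ| ≤ ‖gradient F x‖ := abs_fderiv_eZ_le_norm_gradient_pld F x
    have hMn_abs : |Mn x| = |Φ x * c x| * |deriv H (F x)| * |fderiv ℝ F x eZ| * ω2 (x 2) := by
      simp only [hMn, abs_mul, abs_of_nonneg hw0]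
      ring
    rw [hMn_abs]
    have hstep : |Φ x * c x| * |deriv H (F x)| * |fderiv ℝ F x eZ| ≤
        2 * (|deriv H (F x)| * ‖gradient F x‖ * |ψ x|) * (CΦ * ‖gradient ψ x‖) := by
      have h4 : 0 ≤ |deriv H (F x)| := abs_nonneg _
      calc |Φ x * c x| * |deriv H (F x)| * |fderiv ℝ F x eZ|
          ≤ (2 * |ψ x| * (CΦ * ‖gradient ψ x‖)) * |deriv H (F x)| * ‖gradient F x‖ := by
            gcongr
        _ = 2 * (|deriv H (F x)| * ‖gradient F x‖ * |ψ x|) * (CΦ * ‖gradient ψ x‖) := by ring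
    have hY : 2 * (|deriv H (F x)| * ‖gradient F x‖ * |ψ x|) * (CΦ * ‖gradient ψ x‖) ≤
        ε * (|deriv H (F x)| * ‖gradient F x‖ * |ψ x|) ^ 2 + ε⁻¹ * (CΦ * ‖gradient ψ x‖) ^ 2 := by
      set X : ℝ := |deriv H (F x)| * ‖gradient F x‖ * |ψ x|
      set Y : ℝ := CΦ * ‖gradient ψ x‖
      have h := sq_nonneg (ε * X - Y)
      have hε1 : ε * ε⁻¹ = 1 := mul_inv_cancel₀ hε.ne'
      nlinarith [h, hε.le, sq_nonneg Y, mul_nonneg hε.le (sq_nonneg (X - ε⁻¹ * Y)), hε1]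
    calc |Φ x * c x| * |deriv H (F x)| * |fderiv ℝ F x eZ| * ω2 (x 2)
        ≤ (2 * (|deriv H (F x)| * ‖gradient F x‖ * |ψ x|) * (CΦ * ‖gradient ψ x‖)) * ω2 (x 2) :=
          mul_le_mul_of_nonneg_right hstep hw0
      _ ≤ (ε * (|deriv H (F x)| * ‖gradient F x‖ * |ψ x|) ^ 2 + ε⁻¹ * (CΦ * ‖gradient ψ x‖) ^ 2) * ω2 (x 2) :=
          mul_le_mul_of_nonneg_right hY hw0
      _ = _ := by rw [mul_pow, mul_pow, mul_pow, sq_abs, sq_abs, div_eq_mul_inv]; ring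
  -- the right-hand sides as window integrals, then as slab integrals
  set R₁ : EuclideanSpace ℝ (Fin 3) → ℝ := fun x =>
    deriv H (F x) ^ 2 * ‖gradient F x‖ ^ 2 * ψ x ^ 2 with hR₁
  set R₂ : EuclideanSpace ℝ (Fin 3) → ℝ := fun x => ‖gradient ψ x‖ ^ 2 with hR₂
  have hgradF : Continuous (gradient F) := continuous_gradient_of_contDiff hF1
  have hH'c : Continuous (deriv H) := hH.continuous_deriv (by norm_num)
  have hR₁c : Continuous R₁ := (((hH'c.comp hF.continuous).pow 2).mul (hgradF.norm.pow 2)).mul (hψ.continuous.pow 2)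
  have hgradψ : Continuous (gradient ψ) := continuous_gradient_of_contDiff hψ'
  have hR₂c : Continuous R₂ := hgradψ.norm.pow 2
  have hR₁0 : ∀ x, ρ ≤ cylRadius x → R₁ x = 0 := fun x hx => by simp only [hR₁, hψ0 x hx]; ring
  have hR₂0 : ∀ x, ρ + 1 ≤ cylRadius x → R₂ x = 0 := fun x hx => by
    simp only [hR₂, gradient_eq_zero_of_le_cylRadius_pld hψ0 hx, norm_zero]; ring
  have hg1 : IsAxiallyPeriodic P (gradient F) := periodic_of_eZ_pld fun x => by
    simp only [gradient, periodic_apply_pld (periodic_fderiv_pld hFp)]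
  have hgψ : IsAxiallyPeriodic P (gradient ψ) := periodic_of_eZ_pld fun x => by
    simp only [gradient, periodic_apply_pld (periodic_fderiv_pld hψp)]
  have hR₁p : IsAxiallyPeriodic P R₁ := periodic_of_eZ_pld fun x => by
    simp only [hR₁, periodic_apply_pld hFp, periodic_apply_pld hg1, periodic_apply_pld hψp]
  have hR₂p : IsAxiallyPeriodic P R₂ := periodic_of_eZ_pld fun x => by
    simp only [hR₂, periodic_apply_pld hgψ]
  obtain ⟨hR₁w, -⟩ := integral_mul_window_sq_eq_and_deriv_eq_zero hP hR₁c hR₁p hR₁0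
  obtain ⟨hR₂w, -⟩ := integral_mul_window_sq_eq_and_deriv_eq_zero hP hR₂c hR₂p hR₂0
  have hiR₁ : Integrable (fun x => R₁ x * periodicWindow P (x 2) ^ 2)
      (volume : Measure (EuclideanSpace ℝ (Fin 3))) :=
    (hR₁c.mul (hW2c.comp hx2c)).integrable_of_hasCompactSupport
      (hasCompactSupport_mul_comp_apply_two (W := ω2) hR₁0 hW2)
  have hiR₂ : Integrable (fun x => R₂ x * periodicWindow P (x 2) ^ 2)
      (volume : Measure (EuclideanSpace ℝ (Fin 3))) :=
    (hR₂c.mul (hW2c.comp hx2c)).integrable_of_hasCompactSupport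
      (hasCompactSupport_mul_comp_apply_two (W := ω2) hR₂0 hW2)
  rw [← hR₁w, ← hR₂w]
  calc |-∫ x, Mn x| = |∫ x, Mn x| := abs_neg _
    _ ≤ ∫ x, |Mn x| := abs_integral_le_integral_abs
    _ ≤ ∫ x, (ε * (R₁ x * periodicWindow P (x 2) ^ 2) + CΦ ^ 2 / ε * (R₂ x * periodicWindow P (x 2) ^ 2)) := by
        refine integral_mono_of_nonneg (Eventually.of_forall fun x => abs_nonneg _)
          ((hiR₁.const_mul ε).add (hiR₂.const_mul (CΦ ^ 2 / ε))) (Eventually.of_forall fun x => ?_)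
        have h := hpt x
        simp only [hR₁, hR₂, hω2] at h ⊢
        refine h.trans (le_of_eq ?_)
        ring
    _ = ε * (∫ x, R₁ x * periodicWindow P (x 2) ^ 2) +
          CΦ ^ 2 / ε * ∫ x, R₂ x * periodicWindow P (x 2) ^ 2 := by
        rw [integral_add (hiR₁.const_mul ε) (hiR₂.const_mul (CΦ ^ 2 / ε)),
          MeasureTheory.integral_const_mul, MeasureTheory.integral_const_mul]

end Terms

end LeiRenZhang2019

end Literature.Analysis.FluidPDE

end
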